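import Summits.BirchSwinnertonDyer.BirchSwinnertonDyer.Theorems.PrintCf2SplitBadTwoCMPrimaryConjugationTransport
import HarnessLib

/-!
# Crux `PrintCf2.SplitBadTwoRankOneOfFacts` (item stmt-BirchSwinnertonDyer-20368), road α over the CM field:
# THE `v ↔ v̄` SWAP OF THE PINNING CLAUSE — the module pinned at `v` («`W[v̄^∞]`») is of kernel-of-reduction type at `v̄`

Cell `bsd-print-cf2`, width seat `bsd-line-cf2-p1-w2` g8; `--supports stmt-BirchSwinnertonDyer-20368` (helper). HONEST FRAMING: nothing
here closes a crux or a stub; BSD is not proved by any of this; no summit statement is proved by this seat. THEOREMS ONLY (no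
definition, no named fact, no `sorry`). FILE 4 of the -w2 g8 pinning series (engine: FILE 3 `…CMPrimaryConjugationTransport`).

THE QUESTION (TURNKEY-20368-pinning-w2g8 «Still NOT in the tree (b)»; v9.1 S3c₂ `stub_restrictedEulerCharBottom_two`: «`Ш(W/K)[v^∞] ≅
Ш(W/K)[v̄^∞]` by `c`», the local index at `𝔭* = v̄`). FILE 2 proved that at EACH degree-one `𝔭 ∣ 2` exactly one of `E[𝔮_r^∞]`, `E[𝔮_{1−r}^∞]`
satisfies the pinning clause «`GreenbergSelmer.inertia 𝔭` acts through `{±1}`», without relating the two places `v`, `v̄` of the frame. Here: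
the roots selected at `v` and at `v̄` are COMPLEMENTARY.

* `endEigenPrimaryTorsion_two_inertia_smul_swap` — `W/ℚ` elliptic, `j = −3375`, `K` imaginary quadratic with `θ² = −7`, `v ≠ v̄` above `2`,
  `π² = π − 2`, `ρ² = ρ − 2`: if `GreenbergSelmer.inertia v` acts on `E[𝔮_ρ^∞]` pointwise as `±1`, then `GreenbergSelmer.inertia v̄` acts on
  `E[𝔮_{1−ρ}^∞]` as `+1` or `−1` and some element of it moves a point of `E[𝔮_ρ^∞]` off `±` itself;
* `endEigenPrimaryTorsion_two_pinningClause_swap` — the same in the currency of the registered stubs (the clause on the subtype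
  `↥((W.baseChange K).endEigenPrimaryTorsion 2 π r)`): pinned `(π, r)` at `v` ⟹ pinned `(π, 1 − r)` at `v̄` and NOT pinned `(π, r)` at `v̄`;
* `endEigenPrimaryTorsion_two_localTypes_at_conj` — hence (FILE 2's `endEigenPrimaryTorsion_two_localTypes` at `v̄` + uniqueness) the module
  pinned at `v` carries at `v̄` the KERNEL-OF-REDUCTION character: every `σ ∈ Γ_{K_v̄}` of Frobenius degree `n` acts on `E[𝔮_ρ^∞][2^k]` as any
  `N ≡ ±ε(res σ)·α^{−n} (mod 2^k)`, and on `E[𝔮_{1−ρ}^∞][2^k]` as any `N ≡ ±αⁿ`, `α² = α − 2` a unit, `α ∈ {ρ, 1 − ρ}`.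

THE ARGUMENT. By FILE 2's dichotomy at `v̄` the alternative is that `E[𝔮_ρ^∞]` satisfies the clause at `v` AND `v̄`, hence — every place of `K`
above `2` being `v` or `v̄`, and all primes of `\bar ℤ_K` above one place being `Γ_K`-conjugate — the inertia group of EVERY prime `𝔔 ∋ 2` of
`\bar ℤ_K` acts on it as `±1`. Transport this along FILE 3's anti-commuting lift `τ = e σ₀ e⁻¹` (`τ E[𝔮_ρ^∞] = E[𝔮_{1−ρ}^∞]`,
`τ⁻¹ I_𝔔 τ ≤ I_{𝔔'}`, `𝔔' ∋ 2`): the same holds for `E[𝔮_{1−ρ}^∞]`, contradicting the failure of the clause for `E[𝔮_{1−ρ}^∞]` at `v̄`. No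
identification `τ|_K = c`, `c • v = v̄` is needed. This is `c(E[𝔭^∞]) = E[𝔭̄^∞]` (Rubin LNM 1716 §3; Gross 1991 §5 (5.1)) for the additive
twists of `49a1`, in the kernel's currency; beyond-print theorem: no.

References: K. Rubin, LNM 1716 (1999) §3 Lemma 3.6 (ii), Thm. 3.15 (ii), Cor. 3.17; B. H. Gross, LMS LNS 153 (1991) §5 (5.1); A. Agboola,
Compositio 143 (2007) §6, Prop. 8.1; R. Greenberg, LNM 1716 (1999) §2 p. 70; [NeukirchANT1999] Ch. I §8 (8.2), §9 (9.1), (9.6).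
-/

noncomputable section

open scoped Classical Pointwise

set_option linter.dupNamespace false
set_option autoImplicit false

namespace Summit.BirchSwinnertonDyer.BirchSwinnertonDyer.Theorems.PrintCf2.CMPrimes

open WeierstrassCurve Literature.NumberTheory.EllipticCurves Literature.NumberTheory.GaloisRepresentations Field NumberField
  IsDedekindDomain

/-! ## §4 THE SWAP: pinned as `ρ` at `v` ⟹ pinned as `1 − ρ` at `v̄` -/

section Swap

variable (W : WeierstrassCurve ℚ) [W.IsElliptic] (K : Type) [Field K] [NumberField K]

/-- **THE `v ↔ v̄` SWAP OF THE PINNING CLAUSE.** `W/ℚ` elliptic with `j = −3375`, `K` imaginary quadratic with `θ² = −7`, `v ≠ v̄` the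
two places above `2`, `π ∈ End_K(E_K)` with `π² = π − 2`, `ρ` a `2`-adic root of `X² − X + 2`. If `GreenbergSelmer.inertia v` acts on
`E[𝔮_ρ^∞] = (W.baseChange K).endEigenPrimaryTorsion 2 π ρ` pointwise as `±1` (the module is «`W[v̄^∞]`», pinned at `v`), then AT `v̄` the
roles are SWAPPED: `GreenbergSelmer.inertia v̄` acts on `E[𝔮_{1−ρ}^∞]` as `+1` or `−1`, and some element of it moves a point of
`E[𝔮_ρ^∞]` off `±` itself — `E[𝔮_ρ^∞]` is of kernel-of-reduction type at `v̄`. Proof: by the local dichotomy at `v̄`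
(`endEigenPrimaryTorsion_two_inertia_smul`) the alternative is that `E[𝔮_ρ^∞]` satisfies the clause at `v` AND at `v̄`, i.e. (every place
above `2` being `v` or `v̄`) the inertia group of EVERY prime `𝔔 ∋ 2` of `\bar ℤ_K` acts on it as `±1` (`forall_prime_inertia_smul_eq_or_neg`);
transporting along the anti-commuting lift `τ = e σ₀ e⁻¹` (`exists_transport_anticommute`: `τ E[𝔮_ρ^∞] = E[𝔮_{1−ρ}^∞]`, `τ⁻¹ I_𝔔 τ =
I_{τ⁻¹𝔔}`) the same would hold for `E[𝔮_{1−ρ}^∞]` — contradicting the failure of the clause for `E[𝔮_{1−ρ}^∞]` at `v̄`. This is the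
complex-conjugation symmetry `c(E[𝔭^∞]) = E[𝔭̄^∞]`, `c(v) = v̄` of the CM theory, in the kernel's currency.
[cite: Rubin1999, §3 Lemma 3.6 (ii) and Cor. 3.17] [cite: GrossLMS1991, §5 (5.1)] [cite: NeukirchANT1999, Ch. I §9 Prop. (9.1), (9.6)] -/
theorem endEigenPrimaryTorsion_two_inertia_smul_swap (hj : W.j = -3375) (hK : IsImaginaryQuadratic K) {θ : K} (hθ : θ ^ 2 = -7)
    (π : (W.baseChange K).endRing) (hrel : (π : AddMonoid.End (W.baseChange K).geomPoints) * π = π - 2)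
    {ρ : ℤ_[2]} (hρ : ρ * ρ = ρ - 2) {v vbar : HeightOneSpectrum (𝓞 K)}
    (hv : ((2 : ℕ) : 𝓞 K) ∈ v.asIdeal) (hvbar : ((2 : ℕ) : 𝓞 K) ∈ vbar.asIdeal) (hne : vbar ≠ v)
    (hclause : ∀ τ ∈ GreenbergSelmer.inertia v, ∀ x ∈ (W.baseChange K).endEigenPrimaryTorsion 2 π ρ, τ • x = x ∨ τ • x = -x) :
    (∀ τ ∈ GreenbergSelmer.inertia vbar, (∀ x ∈ (W.baseChange K).endEigenPrimaryTorsion 2 π (1 - ρ), τ • x = x) ∨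
        (∀ x ∈ (W.baseChange K).endEigenPrimaryTorsion 2 π (1 - ρ), τ • x = -x)) ∧
      (∃ τ ∈ GreenbergSelmer.inertia vbar, ∃ x ∈ (W.baseChange K).endEigenPrimaryTorsion 2 π ρ, τ • x ≠ x ∧ τ • x ≠ -x) := by
  haveI : Fact (Nat.Prime 2) := ⟨Nat.prime_two⟩
  haveI : IsGalois ℚ K := Literature.FieldTheory.Galois.isGalois_of_finrank_eq_two (F := ℚ) hK.1
  -- the local dichotomy at `v̄`
  obtain ⟨ρ₁, ρ₂, hρρ, huni, τ₀, hτ₀, x₀, hx₀, hx₀₁, hx₀₂⟩ := endEigenPrimaryTorsion_two_inertia_smul W K hj hθ π hrel hρ vbar hvbar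
    (inertiaDeg_eq_one_of_ne_two K hK.1 hvbar hv hne.symm)
  rcases hρρ with ⟨rfl, rfl⟩ | ⟨rfl, rfl⟩
  · -- `E[𝔮_ρ^∞]` satisfies the clause at `v̄` too: contradiction via the transport
    exfalso
    -- clause at every place above `2`
    have hall : ∀ w : HeightOneSpectrum (𝓞 K), ((2 : ℕ) : 𝓞 K) ∈ w.asIdeal →
        ∀ τ ∈ GreenbergSelmer.inertia w, ∀ x ∈ (W.baseChange K).endEigenPrimaryTorsion 2 π ρ₁, τ • x = x ∨ τ • x = -x := by
      intro w hw τ hτ x hx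
      rcases eq_or_eq_of_two_mem K hK.1 hv hvbar hne hw with rfl | rfl
      · exact hclause τ hτ x hx
      · rcases huni τ hτ with h | h
        · exact Or.inl (h x hx)
        · exact Or.inr (h x hx)
    have hP := forall_prime_inertia_smul_eq_or_neg W K π ρ₁ hall
    -- the anti-commuting transport lift and the transported clause for `E[𝔮_{1−ρ}^∞]`
    obtain ⟨σ₀, ht, hanti⟩ := exists_transport_anticommute W K π hrel
    have hP' := forall_prime_inertia_smul_eq_or_neg_of_transport W K π ρ₁ ht hanti hP
    -- at `𝔔 = 𝔓₀(v̄)`: contradiction with the failure witness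
    have h𝔓 := adicCompletionPrime_mem_primesAbove K vbar
    have h2𝔓 : ((2 : ℕ) : absIntegers (𝓞 K) K) ∈ adicCompletionPrime K vbar := by
      have := h𝔓.2.over ▸ hvbar
      rw [Ideal.under_def, Ideal.mem_comap, map_natCast] at this
      exact this
    have hτ₀' : τ₀ ∈ (adicCompletionPrime K vbar).inertia (absoluteGaloisGroup K) := by
      rw [inertia_adicCompletionPrime_eq_map_absInertia K vbar]
      exact hτ₀
    rcases hP' _ h𝔓.1 h2𝔓 τ₀ hτ₀' x₀ hx₀ with h | h
    · exact hx₀₁ h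
    · exact hx₀₂ h
  · exact ⟨huni, τ₀, hτ₀, x₀, hx₀, hx₀₁, hx₀₂⟩

/-- **THE v9 PINNING CLAUSE SWAPS BETWEEN `v` AND `v̄`** (currency of `stub_restrictedMainConj_two` / `stub_restrictedEulerCharBottom_two`:
the clause on the subtype `↥((W.baseChange K).endEigenPrimaryTorsion 2 π r)` with its restricted `Γ_K`-action). If `(π, r)` is pinned at
`v` — `∀ τ ∈ GreenbergSelmer.inertia v, ∀ x : ↥(E[𝔮_r^∞]), τ • x = x ∨ τ • x = -x` — then `(π, 1 − r)` is pinned at `v̄` and `(π, r)` is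
NOT pinned at `v̄`. [cite: Rubin1999, §3 Lemma 3.6 (ii) and Cor. 3.17] [cite: GrossLMS1991, §5 (5.1)] -/
theorem endEigenPrimaryTorsion_two_pinningClause_swap (hj : W.j = -3375) (hK : IsImaginaryQuadratic K) {θ : K} (hθ : θ ^ 2 = -7)
    (π : (W.baseChange K).endRing) (hrel : (π : AddMonoid.End (W.baseChange K).geomPoints) * π = π - 2)
    {r : ℤ_[2]} (hr : r * r = r - 2) {v vbar : HeightOneSpectrum (𝓞 K)}
    (hv : ((2 : ℕ) : 𝓞 K) ∈ v.asIdeal) (hvbar : ((2 : ℕ) : 𝓞 K) ∈ vbar.asIdeal) (hne : vbar ≠ v)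
    (hclause : ∀ τ ∈ GreenbergSelmer.inertia v, ∀ x : ↥((W.baseChange K).endEigenPrimaryTorsion 2 π r), τ • x = x ∨ τ • x = -x) :
    (∀ τ ∈ GreenbergSelmer.inertia vbar, ∀ x : ↥((W.baseChange K).endEigenPrimaryTorsion 2 π (1 - r)), τ • x = x ∨ τ • x = -x) ∧
      ¬ (∀ τ ∈ GreenbergSelmer.inertia vbar, ∀ x : ↥((W.baseChange K).endEigenPrimaryTorsion 2 π r), τ • x = x ∨ τ • x = -x) := by
  have hclause' : ∀ τ ∈ GreenbergSelmer.inertia v, ∀ x ∈ (W.baseChange K).endEigenPrimaryTorsion 2 π r, τ • x = x ∨ τ • x = -x := by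
    intro τ hτ x hx
    rcases hclause τ hτ ⟨x, hx⟩ with h | h
    · exact Or.inl (by simpa [endEigenPrimaryTorsion.coe_smul] using congrArg Subtype.val h)
    · exact Or.inr (by simpa [endEigenPrimaryTorsion.coe_smul] using congrArg Subtype.val h)
  obtain ⟨huni, τ, hτ, x, hx, hx₁, hx₂⟩ :=
    endEigenPrimaryTorsion_two_inertia_smul_swap W K hj hK hθ π hrel hr hv hvbar hne hclause'
  refine ⟨fun τ hτ x ↦ ?_, fun h ↦ ?_⟩
  · rcases huni τ hτ with h | h
    · exact Or.inl (Subtype.ext (by rw [endEigenPrimaryTorsion.coe_smul]; exact h x x.2))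
    · exact Or.inr (Subtype.ext (by rw [endEigenPrimaryTorsion.coe_smul, AddSubgroup.coe_neg]; exact h x x.2))
  · rcases h τ hτ ⟨x, hx⟩ with h | h
    · exact hx₁ (by simpa [endEigenPrimaryTorsion.coe_smul] using congrArg Subtype.val h)
    · exact hx₂ (by simpa [endEigenPrimaryTorsion.coe_smul] using congrArg Subtype.val h)

/-- **THE MODULE PINNED AT `v` IS OF KERNEL-OF-REDUCTION TYPE AT `v̄`** (and its partner of unramified-twist type there). With the data of
`endEigenPrimaryTorsion_two_inertia_smul_swap` (clause at `v` for `E[𝔮_ρ^∞]`): there is a unit `α`, `α² = α − 2`, `α ∈ {ρ, 1 − ρ}`, such that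
every `σ ∈ Γ_{K_v̄}` of Frobenius degree `n` acts on `E[𝔮_ρ^∞][2^k]` as any `N ≡ ±ε(res σ)·α^{−n} (mod 2^k)` and on `E[𝔮_{1−ρ}^∞][2^k]` as any
`N ≡ ±αⁿ (mod 2^k)` — the local input at `𝔭* = v̄` of Agboola's §6 / Prop. 8.1 bookkeeping for `W* = W[v̄^∞]` (the formal group at `v̄`), now
for the module pinned at `v` as the v9 stubs do it. (`endEigenPrimaryTorsion_two_localTypes` at `v̄` + the swap + uniqueness.)
[cite: Rubin1999, §3 Lemma 3.6 (ii), Thm. 3.15 (ii), Cor. 3.17] [cite: Agboola2007, §6 and Prop. 8.1] [cite: GreenbergLNM1716, §2 p. 70] -/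
theorem endEigenPrimaryTorsion_two_localTypes_at_conj (hj : W.j = -3375) (hK : IsImaginaryQuadratic K) {θ : K} (hθ : θ ^ 2 = -7)
    (π : (W.baseChange K).endRing) (hrel : (π : AddMonoid.End (W.baseChange K).geomPoints) * π = π - 2)
    {ρ : ℤ_[2]} (hρ : ρ * ρ = ρ - 2) {v vbar : HeightOneSpectrum (𝓞 K)}
    (hv : ((2 : ℕ) : 𝓞 K) ∈ v.asIdeal) (hvbar : ((2 : ℕ) : 𝓞 K) ∈ vbar.asIdeal) (hne : vbar ≠ v)
    (hclause : ∀ τ ∈ GreenbergSelmer.inertia v, ∀ x ∈ (W.baseChange K).endEigenPrimaryTorsion 2 π ρ, τ • x = x ∨ τ • x = -x) :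
    ∃ α : ℤ_[2]ˣ, (α : ℤ_[2]) ^ 2 = (α : ℤ_[2]) - 2 ∧ ((α : ℤ_[2]) = ρ ∨ (α : ℤ_[2]) = 1 - ρ) ∧
      (∀ (σ : absoluteGaloisGroup (vbar.adicCompletion K)) (n : ℕ), IsFrobPow σ (n : ℤ) →
        ∃ s : ℤ, (s = 1 ∨ s = -1) ∧
          ∀ (k : ℕ), ∀ x ∈ (W.baseChange K).endEigenPrimaryTorsion 2 π ρ, 2 ^ k • x = 0 →
            ∀ N : ℤ, ((N : ℤ_[2]) - s *
                ((GaloisRep.cyclotomicCharacter K 2 (absGaloisRestrict K (vbar.adicCompletion K) σ) * (α⁻¹) ^ n :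
                  ℤ_[2]ˣ) : ℤ_[2])) ∈ (Ideal.span {(2 : ℤ_[2]) ^ k} : Ideal ℤ_[2]) →
              absGaloisRestrict K (vbar.adicCompletion K) σ • x = N • x) ∧
      (∀ (σ : absoluteGaloisGroup (vbar.adicCompletion K)) (n : ℕ), IsFrobPow σ (n : ℤ) →
        ∃ s : ℤ, (s = 1 ∨ s = -1) ∧
          ∀ (k : ℕ), ∀ x ∈ (W.baseChange K).endEigenPrimaryTorsion 2 π (1 - ρ), 2 ^ k • x = 0 →
            ∀ N : ℤ, ((N : ℤ_[2]) - s * ((α ^ n : ℤ_[2]ˣ) : ℤ_[2])) ∈ (Ideal.span {(2 : ℤ_[2]) ^ k} : Ideal ℤ_[2]) →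
              absGaloisRestrict K (vbar.adicCompletion K) σ • x = N • x) := by
  obtain ⟨huni, -⟩ := endEigenPrimaryTorsion_two_inertia_smul_swap W K hj hK hθ π hrel hρ hv hvbar hne hclause
  obtain ⟨ρ₁, ρ₂, α, hρρ, hα, hαρ, hU, hR, τ₀, hτ₀, k, x, hx, -, hx₁, hx₂⟩ :=
    endEigenPrimaryTorsion_two_localTypes W K hj hθ π hrel hρ vbar hvbar (inertiaDeg_eq_one_of_ne_two K hK.1 hvbar hv hne.symm)
  rcases hρρ with ⟨rfl, rfl⟩ | ⟨rfl, rfl⟩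
  · -- the failure witness at `v̄` lies in `E[𝔮_{1−ρ}^∞]`, where the clause holds: absurd
    exfalso
    have hmem : absGaloisRestrict K (vbar.adicCompletion K) τ₀ ∈ GreenbergSelmer.inertia vbar :=
      Subgroup.mem_map.mpr ⟨τ₀, isFrobPow_zero_iff_mem_absInertia.mp hτ₀, rfl⟩
    rcases huni _ hmem with h | h
    · exact hx₁ (h x hx)
    · exact hx₂ (h x hx)
  · exact ⟨α, hα, hαρ, hR, hU⟩

end Swap

end Summit.BirchSwinnertonDyer.BirchSwinnertonDyer.Theorems.PrintCf2.CMPrimes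

end
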